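import Summits.BirchSwinnertonDyer.BirchSwinnertonDyer.Theorems.ErratumRoadFiveControlFromJSWMult
import Summits.BirchSwinnertonDyer.Rank1Residual.X11b.HalvesReceptacle
import HarnessLib

/-!
# Route `ErratumRoadFive`, crux `OpenInputNotRam` (item stmt-BirchSwinnertonDyer-19282), registered
# stub `stub_charTorsionNotRam` (CTL₀ at `p` on the (¬ram) atom) — FROM PRINT: Jetchev–Skinner–Wan 2017
# Thm. 3.3.1 at a multiplicative `p` + Kolyvagin

Cell `bsd-stepL` (run/shared/lean/pub/bsd-stepL/), seat `bsd-stepL-nram2` (prover, PART 1b residue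
fan-out, 2026-08-26), `--supports stmt-BirchSwinnertonDyer-19282`. The registered BC3 skeleton
`Cruxes/OpenInputNotRam/Lines/birth.lean` (planner g25, sha16 b078920a0adb81b4) composes four mechanism
stubs into the crux by `OpenInputNotRam_of`; its first stub `stub_charTorsionNotRam` asks, at every
classical X11b datum of a (¬ram) pair (`p ≥ 5`, `ρ̄_{E,p}` onto, `K` an odd-discriminant Heegner field
with `p` split, a Manin-good parametrisation datum, the Heegner point `P` of infinite order,
anticyclotomic `(κ, γ)`, a degree-one prime `𝔭 ∋ p`), for CTL₀: `∃ n, XAc.HasCharValuationAt (E/K) p κ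
𝔭 ∅ γ n` — `X_ac^∅(E/K_∞)` is `Λ`-torsion with a characteristic power series of non-zero constant term.

HONEST FRAMING: BSD is NOT proved by any of this; a closed item closes a rung leaf (K2), never summit
credit; X11b stays CONSTRUCTION-SHAPED. THEOREMS ONLY (no definition, no named fact, no `sorry`);
CONDITIONAL on the two PUBLISHED named facts it lists (`thm331_anticyclotomicControl_mult`, JSW17
Thm. 3.3.1 at a multiplicative `p`; `kolyvagin`, Kolyvagin 1990 Thm. A). The binder `¬ Ram W p` and
`5 ≤ p` are not used: the control identity holds at EVERY X11b pair (imc-t1's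
`p2ControlOnTree_odd_of_thm331Mult`, p428223's companion), and CTL₀ is its first conjunct
(`Halves.exists_hasCharValuationAt_of_controlOnTreeAt`).

* `openInputNotRam_stub_charTorsionNotRam_of_thm331Mult` — the registered signature of
  `Cruxes.OpenInputNotRam.Birth.stub_charTorsionNotRam` VERBATIM (fully qualified), from the two facts.

References: [JetchevSkinnerWan2017] Thm. 3.3.1 with §3.5 (3.5.c) (arXiv:1512.06894 pp. 11, 15);
[Kolyvagin1990] Thm. A; [Gross1991] Thm. 1.3; [Castella2018] Thm. 2.3 (the CTL₀ shape).
-/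

set_option autoImplicit false
set_option linter.dupNamespace false

noncomputable section

open scoped Classical

open WeierstrassCurve NumberField IsDedekindDomain Field
open Literature.NumberTheory.EllipticCurves Literature.NumberTheory.EllipticCurves.ModularForms
  Literature.NumberTheory.EllipticCurves.Rank1Residual
  Literature.NumberTheory.EllipticCurves.JetchevSkinnerWan2017
open Summit.BirchSwinnertonDyer.Rank1Residual Summit.BirchSwinnertonDyer.Rank1Residual.X11b
  Summit.BirchSwinnertonDyer.Rank1Residual.X11b.AcSelmer
  Summit.BirchSwinnertonDyer.Rank1Residual.X11b.Halves

namespace Summit.BirchSwinnertonDyer.BirchSwinnertonDyer.Theorems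

/-- **Stub `stub_charTorsionNotRam` of crux `OpenInputNotRam` (item 19282) FROM PRINT.** At every
classical X11b datum of a (¬ram) pair — the registered binders VERBATIM — `X_ac^∅(E/K_∞)` is
`Λ`-torsion with a characteristic power series of non-zero constant term:
`∃ n, XAc.HasCharValuationAt (E/K) p κ 𝔭 ∅ γ n`. Proof: the pair is in X11b, so `p` is multiplicative
and odd; `ρ̄_{E,p}` onto gives `E[p]` irreducible over `G_K` (`irrK_of_surj`); Kolyvagin at the
non-torsion Heegner point gives `rank_ℤ E(K) = 1`, `#Ш(E/K) < ∞`; Jetchev–Skinner–Wan Thm. 3.3.1 then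
gives the tree's full control identity `ControlOnTreeAt p κ 𝔭 γ (embAt K p 𝔭) P`
(`p2ControlOnTree_odd_of_thm331Mult`), whose first conjunct is CTL₀
(`Halves.exists_hasCharValuationAt_of_controlOnTreeAt`). The binders `¬ Ram W p`, `5 ≤ p` are idle.
CONDITIONAL on the two named facts; nothing booked.
[cite: JetchevSkinnerWan2017, Thm. 3.3.1 with §3.5 (3.5.c) (arXiv:1512.06894 pp. 11, 15)]
[cite: Kolyvagin1990, Thm. A] [cite: Castella2018, Thm. 2.3 (arXiv:1704.06608 p. 5) (shape)] -/
theorem openInputNotRam_stub_charTorsionNotRam_of_thm331Mult (h : thm331_anticyclotomicControl_mult)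
    (hKo : ∀ (N : ℕ) [NeZero N] (W : WeierstrassCurve ℚ) (K : Type) [Field K] [NumberField K],
      kolyvagin N W K) :
    ∀ (W : WeierstrassCurve ℚ) [W.IsElliptic] [W.IsGloballyMinimal] (p : ℕ) [Fact p.Prime]
      (N : ℕ) [NeZero N] (K : Type) [Field K] [NumberField K]
      (Dt : ModularParametrizationData W N) (H : HeegnerDatum N (NumberField.discr K)) (ι : K →+* ℂ)
      (P : (W.baseChange K).toAffine.Point),
      ¬ Literature.NumberTheory.EllipticCurves.Rank1Residual.Ram W p →
      ClassX11b W p → 5 ≤ p → Surj W p → W.conductorNorm ℤ = N → IsImaginaryQuadratic K →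
      Odd (NumberField.discr K) → ¬ (p : ℤ) ∣ NumberField.discr K → ¬ p ∣ Units.torsionOrder K →
      SatisfiesHeegnerHypothesis N K →
      (W.quadraticTwist (NumberField.discr K : ℚ)).entireLFunction 1 ≠ 0 →
      WeierstrassCurve.Affine.Point.map ι.toRatAlgHom P = heegnerPointComplex Dt H →
      ¬ (p : ℤ) ∣ Dt.c → ¬ IsOfFinAddOrder P →
      ∀ (κ : ZpExtension K p), κ.IsAnticyclotomic →
        ∀ (γ : Field.absoluteGaloisGroup K) [Fact (κ.IsTopGenerator γ)]
          (𝔭 : HeightOneSpectrum (𝓞 K)), ((p : ℕ) : 𝓞 K) ∈ 𝔭.asIdeal →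
          𝔭.asIdeal.ramificationIdx (𝓞 ℚ) = 1 → 𝔭.asIdeal.inertiaDeg (𝓞 ℚ) = 1 →
          ∃ n : ℕ, XAc.HasCharValuationAt (W.baseChange K) p κ 𝔭 ∅ γ n := by
  intro W _ _ p _ N _ K _ _ Dt H ι P _hnr hX _hp5 hsurj hN hK hodd hdisc htor hheeg hL1 hP hc hP0 κ hκ
    γ _ 𝔭 h𝔭 he hf
  exact exists_hasCharValuationAt_of_controlOnTreeAt W p (embAt K p 𝔭 h𝔭 he hf) P κ 𝔭 γ
    (p2ControlOnTree_odd_of_thm331Mult W p h hKo N K Dt H ι P hX hsurj hN hK hodd hdisc htor hheeg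
      hL1 hP hc hP0 κ hκ γ 𝔭 h𝔭 he hf)

end Summit.BirchSwinnertonDyer.BirchSwinnertonDyer.Theorems

end
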